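import Summits.QuantumFields.YangMills.Theorems.AlphaInputsT3ACv3LocalSmallRead
import Summits.QuantumFields.YangMills.Theorems.BalabanUVNodesN20LCSHullInSmallField
import Literature.MathematicalPhysics.QuantumFieldTheory.Balaban1983to89.Node00.TorusCoverCubeMember
import Literature.MathematicalPhysics.QuantumFieldTheory.Balaban1983to89.Node00.LargeFieldBackgroundCoPOfRecord
import Literature.MathematicalPhysics.QuantumFieldTheory.Balaban1983to89.Node00.CriticalOnFibreTop
import Literature.MathematicalPhysics.QuantumFieldTheory.Balaban1983to89.T4ReflectionCone
import HarnessLib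

/-!
# BalabanUVNodes ∕ N07 — THE TOP-CLASS INSTANCE OF THE LOCAL CHART ROAD: the window-closed bond family over a SEPARATED domain tower and its per-bond
# `α`-guard FROM THE (1.7) HALF OF PRINT'S CLASS (6) ON THE TOP DOMAIN; pins over the tower; ⇒ the per-level lifts ∕ (45) at `U` ∕ 35a's `IsFibreChartNear` ∕
# the (82) tangent form ∕ the (141) current form for a curve-critical `U` of [15] Proposition 8's class, with `hCF`, an `M₁`-floor and an `ε₀`-window the only
# displayed hypotheses

Cell `pub-ymgap`, width seat `pub-ymgap-dag-n07-w2` generation 3 (HUMAN RULING D-0149; DAG node N07 = [15] = [Balaban1985Variational]; W-SEAT START LIST §n07, the w2 lane's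
successor piece (a) of ASK-NEXT 2026-08-28 02:32Z).  `--kind proof --supports stmt-QuantumFields-20542 --as helper` (K1⁷; count-neutral; theorems only, no `def`).

WHY.  Generation 2 closed the chart road to the multi-scale tangent form LOCALLY (`…N07CentralResponseOnto` §4): «curve-critical ⇒ tangent-critical» on a `DetSet`-indexed
fibre holds as soon as (i) the (0.4) loop variables of the iterates `Ū^i U` are within `α` of `1` AT THE BONDS of a family `S` closed downward under the (0.4) window and
containing the pins, and (ii) 35j's chain-free tower family `hCF`.  [15] Proposition 8 (stub 1 of K0⁷, `Node00.Prop8RegSepTopStep`) hands its configuration `U` in the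
class (6) ON A TOP DOMAIN only — (1.7) on `Sect2.omegaPlaqsTop s.Ω Ω₀ n` at radius `ε₀η_n²`, `n ≤ k` — so the whole-torus guard of n07-e's module 35∕37 is not available
(dag-n07-e `STUB1-SECTF-MAP.md` § g16: «the stub-1 consumer route for the tangent form is the LOCAL∕GUARDED edition»).  THIS FILE supplies (i) from that class:
the family is the DEPENDENCY HULL (cell `pub-balaban3d`'s `LocalSmallLoop.hull`) of the pins «level-`j` bonds with an end-point centre in `Ω_j`, `1 ≤ j ≤ k`» (plus
every fine bond), its closure is `LocalSmallLoop.depClosed_hull`, and its guard is `LocalSmallLoop.nestedSmallOn_hull_of_plaqSmallOn_readBoxes` — [B7] Props. 1–2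
LOCAL (dag-n21-c `…N21LocalAveragedRegularity(Levels)`) + local Stokes — fed by ONE fine box of radius `(d+10)·L^j` per pin, which print's separation
«dist(Ω_j, Ωᶜ_{j−1}) ≥ L^jM₁» ([6] (1.3)–(1.6), `Sect2.SeqSeparated`; dag-n07-e `TorusCoverCubeMember.cover_mem_of_within_of_seqSeparated`) and the support of record
`Ω₀ = Ω₁ +` one layer of `M₁`-cubes ([III] p.255, `Node00.suppDomOfRecord`; `B15Claim189LambdaPin.mem_hullD_of_near`) place inside `Ω_{j−1}` (resp. `Ω₀`), where the
class at scale `j − 1` reads `ε₀η_{j−1}² = (ε₀L²)·(L^j)⁻²`.  Floor: `(d+11)·L ≤ M₁`.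

CONTENTS.  §1 torus bookkeeping (`coordDist` of dag-n12-e ∕ dag-n20-c BY NAME).  §2 ★ `readBox_subset_omegaPlaqsTop`: the read box of a pin of level `j` lies in the (1.7)
plaquette set of scale `j − 1`.  §3 ★★ `exists_guardedFamily_of_classTopAt` (any top domain containing the `(d+11)L`-neighbourhood of `Ω₁`, floor `d + 11 ≤ M₁`) ∕
★★ `exists_guardedFamily_of_classTop` (the support of record, floor `(d+11)L ≤ M₁`): `∃ S`, `S 0 = univ`, closed below (the `hS` binder of `…CentralResponseOnto` §4
VERBATIM), `α`-guarded (the `hα` binder VERBATIM, `α ≥ (((d+2)L)²∕4)·(ε₀L² + 2C₀(d)(ε₀L²)²)`), and containing every bond with an end-point centre in `Ω_j` (`1 ≤ j ≤ k`);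
`bondsOf_genSet_subset_of_pins` ([III] (2.2)'s `Γ_j ⊆ Ω_j^{(j)}`: the literal stub-1 pins qualify), `exists_guardedFamily_of_classTop_detSet` (the `h𝔹S` binder for any
level-indexed `𝔹` whose pins sit over the tower).  §4 non-vacuity (A6): `exists_windows` (the `ε₀`∕`α` windows are jointly inhabited for every `(d, L, N)`).
The five consumers of `…CentralResponseOnto` §4 re-keyed on the class ((45) at `U`, `IsFibreChartNear`, the (82) tangent form, the (141) current form, the per-level lifts)
and the A6 certificate of their whole binder block are the companion file `…N07ChartRoadClassTop` (this file's §3 + one line each).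

READINGS (displayed, unchanged).  `hCF`: for print's constraint family [B6] (2.3) it is n07-e's 37a `N07CritMultiScaleLamBond.chainFree_lamBond` once the fibre is keyed by
that family (lit-balaban ME #35: the tree's `bondsOf ∘ genSet` is reading (b); the repair of record is the in-place (ii)-edition of `bondsOf`∕`AgreeOn`); for the literal
(b) family `genSet s.Ω k` of a separated index with a proper non-empty domain it FAILS (this seat's LOCATED reading, not kernel-checked here: the central crossing bond of a
level-`ℓ` pin crossing `∂Ω_ℓ` has an end-point tower in `Ω_{ℓ−1}∖Ω_ℓ`, the `Γ_{ℓ−1}` region), so NO `genSet`-keyed specialisation of the consumers is filed (vacuous outside the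
one-scale corner); they are keyed on an
abstract level-bounded `𝔹` with pins over the tower (`h𝔹Ω`, companion file), which both readings meet (`bondsOf_genSet_subset_of_pins`).

HONEST FRAMING: torus geometry + bookkeeping about the tree's own averaging map; the analytic inputs are [B7] Props. 1–2 local and local Stokes, cited BY NAME from the
d = 3 lane and dag-n21-c; nothing of [15] Sects. B–F asserted; DISPLAYED after this file on the w2 chart road for stub 1's class: `hCF`, the floor `(d+11)L ≤ M₁`, the
`ε₀`∕`α` window; stub 1 ∕ K0⁷ ∕ K1⁷ NOT closed; N07 NOT discharged; counts unmoved (5∕27); one finite T⁴ programme at fixed ε — NOT continuum ∕ ℝ⁴ ∕ OS ∕ mass gap ∕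
Clay: the Yang–Mills mass gap is NOT proved by any of this; R4 closes the conditional rung `BalabanLadder.UV` only.  No `sorry`, no `def`, no `instance`, no `notation`.

References: [15] T. Bałaban, CMP 102 (1985) 277–309 [Balaban1985Variational]; [6] CMP 99 (1985) 75–102 [Balaban1985RegularSpaces]; [B7] CMP 98 (1985) 17–51
[Balaban1985Averaging]; [I] CMP 109 (1987) 249–301 [Balaban1987RG1]; [III] CMP 119 (1988) 243–285 [Balaban1988Convergent]; [B6] CMP 96 (1984) 223–250 [Balaban1984PropagatorsII].
-/

noncomputable section

open scoped Matrix.Norms.L2Operator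

namespace Summit.QuantumFields.YangMills.BalabanUVNodes.N07GuardedFamilyOfClassTop

open Literature.MathematicalPhysics.QuantumFieldTheory.Balaban1983to89
open Literature.MathematicalPhysics.QuantumFieldTheory.Balaban1983to89.T4Continuum (T4Family)
open Literature.MathematicalPhysics.QuantumFieldTheory.Balaban1983to89.B15DeterminingSets
open Literature.MathematicalPhysics.QuantumFieldTheory.Balaban1983to89.Node00
open Literature.MathematicalPhysics.QuantumFieldTheory.Balaban1983to89.BlockAveraging (Small Idx avgFun loopHol blockAvg)
open Literature.MathematicalPhysics.QuantumFieldTheory.Balaban1983to89.ExpMeanLog (expMeanLogSU deltaSU)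
open Literature.MathematicalPhysics.QuantumFieldTheory.Balaban1983to89.B15Claim189LambdaPin (coordDist mem_hullD_of_near exists_lift_near)
open Literature.MathematicalPhysics.QuantumFieldTheory.Balaban1983to89.B15Eq112TorusCover (cover lift cover_lift)
open Literature.MathematicalPhysics.QuantumFieldTheory.Balaban1983to89.B14DomainGeom (Pt Within)
open Literature.MathematicalPhysics.QuantumFieldTheory.Balaban1983to89.B14.Eq213MaximalDomains (side)
open Literature.MathematicalPhysics.QuantumFieldTheory.Balaban1983to89.B8Eq17ClassAkV1 (plaqsOf mem_plaqsOf)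
open Summit.QuantumFields.YangMills.BalabanUVNodes.N20LCSAvgDominationRegion (boxRegion mem_boxRegion)
open Summit.QuantumFields.YangMills.BalabanUVNodes.N20LCSHullSeparation (coordDist_comm coordDist_triangle coordDist_le_natAbs_of_eq_add)
open Summit.QuantumFields.YangMills.BalabanUVNodes.N20LCSHullInSmallField (coordDist_embIter_shift_le)
open Summit.QuantumFields.YangMills.Theorems.LocalSmallLoop (Feeds DepClosed hull subset_hull depClosed_hull NestedSmallOn nestedSmallOn_hull_of_plaqSmallOn_readBoxes)
open Literature.MathematicalPhysics.QuantumFieldTheory.Balaban1983to89.T4ReflectionCone (three_le_L)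

/-! ## §1  Torus bookkeeping (`coordDist` of dag-n12-e ∕ dag-n20-c, n20-d's `boxRegion`, n21-c's `emb`-chains — all BY NAME) -/

section Torus

variable {P : Params}

/-- The bottom of a chain of block centres (`xs l = emb (xs (l+1))`, `l < i`) is the `i`-fold centre `embIter i (xs i)` of its top. [cite: Balaban1987RG1, (0.1) p.251] -/
theorem embChain_zero_eq_embIter : ∀ (i : ℕ) (xs : (l : ℕ) → Site P l), (∀ l, l < i → xs l = emb (xs (l + 1))) → xs 0 = embIter i (xs i)
  | 0, _, _ => rfl
  | i + 1, xs, h => by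
    rw [embChain_zero_eq_embIter i xs fun l hl => h l (Nat.lt_succ_of_lt hl), h i (Nat.lt_succ_self i)]
    rfl

/-- A plaquette of the fine box `boxRegion x ρ` has its corner within `ρ` of `x` in every coordinate (cyclic distance). [cite: Balaban1987RG1, (0.3) p.252 (bookkeeping)] -/
theorem coordDist_le_of_mem_boxRegion_zero {x : Site P 0} {ρ : ℕ} {q : Plaq P 0} (hq : q ∈ boxRegion x ρ) (ν : Fin P.d) :
    coordDist q.src x ν ≤ ρ := by
  obtain ⟨e, he, hqe⟩ := (mem_boxRegion.1 hq) ν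
  refine (coordDist_le_natAbs_of_eq_add hqe).trans ?_
  have : (e.natAbs : ℤ) ≤ (ρ : ℤ) := by rw [Int.natCast_natAbs]; exact he
  exact_mod_cast this

/-- The centres of the two end-points of a bond of `T^{(j)}` are within `L^j` of each other on the fine torus, in every coordinate (dag-n20-c's `coordDist_embIter_shift_le`).
[cite: Balaban1987RG1, (0.1) p.251–252] -/
theorem coordDist_embIter_tgt_le {j : ℕ} (hj : j ≤ P.m + P.K) (b : PBond P j) (ν : Fin P.d) :
    coordDist (embIter j b.src) (embIter j b.tgt) ν ≤ P.L ^ j := by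
  rw [coordDist_comm]
  exact coordDist_embIter_shift_le hj b.src b.dir ν

end Torus

/-! ## §2  At the record: the read box of a pin of level `j` lies in the (1.7) plaquette set of scale `j − 1` -/

section Record

variable {F : T4Family} {N : ℕ} [NeZero N] {K k : ℕ}

/-- **PRINT'S SEPARATION, BALL FORM ON THE TORUS**: along a separated (2.18) index (`Sect2.SeqSeparated M₁ s`, `1 ≤ M₁`), a fine site within cyclic distance `L^{n+1}M₁`
(every coordinate) of a point of `Ω_{n+1}` lies in `Ω_n` (`1 ≤ n < k`) — dag-n07-e's cover form `cover_mem_of_within_of_seqSeparated` read through dag-n12-e's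
`exists_lift_near`. [cite: Balaban1985RegularSpaces, (1.3)–(1.6) p.77; Balaban1988Convergent, (2.1) p.254, p.256] -/
theorem mem_omega_of_coordDist_le {ν : Stage7Numerics} {M : ℕ} {g : ℕ → ℝ} (s : SeqOfRecord F ν M g K k)
    (hsep : Sect2.SeqSeparated ν.M₁ s) (hM₁ : 1 ≤ ν.M₁) {n : ℕ} (hn : 1 ≤ n) (hnk : n < k) {x' z : Site (F.P K) 0}
    (hx' : x' ∈ s.Ω (n + 1)) (h : ∀ i, coordDist z x' i ≤ side (F.P K).L ν.M₁ (n + 1)) : z ∈ s.Ω n := by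
  obtain ⟨w, hwz, hw⟩ := exists_lift_near z x'
  have key := cover_mem_of_within_of_seqSeparated hM₁ s hsep hn hnk (y := lift (F.P K) x') (z := w)
    (by rw [cover_lift]; exact hx') (fun i => ?_)
  · rwa [hwz] at key
  · obtain ⟨h1, h2⟩ := hw i
    have h3 : ((coordDist z x' i : ℕ) : ℤ) ≤ ((side (F.P K).L ν.M₁ (n + 1) : ℕ) : ℤ) := by exact_mod_cast h i
    rw [abs_le]; constructor <;> linarith

/-- **THE SUPPORT OF RECORD CONTAINS THE `M₁`-NEIGHBOURHOOD OF `Ω₁`**: a fine site within cyclic distance `M₁` (every coordinate) of a point of `Ω₁` lies in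
`Node00.suppDomOfRecord` = `Ω₁` + one layer of `M₁`-cubes (`B15Claim189LambdaPin.mem_hullD_of_near`). [cite: Balaban1988Convergent, p.255 («a layer of M₁-cubes … its support»); Balaban1985Variational, (1) p.277] -/
theorem mem_suppDomOfRecord_of_coordDist_le {ν : Stage7Numerics} (hM₁ : 0 < ν.M₁) (Ω : ℕ → Set (Site (F.P K) 0)) {x' z : Site (F.P K) 0}
    (hx' : x' ∈ Ω 1) (h : ∀ i, coordDist z x' i ≤ ν.M₁) : z ∈ suppDomOfRecord F ν K Ω :=
  mem_hullD_of_near hM₁ hx' fun i => by rw [coordDist_comm, one_mul]; exact h i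

/-- ★ **THE READ BOX OF A PIN LIES IN THE PREVIOUS DOMAIN.**  Let `s` be a separated (2.18) index with `d + 11 ≤ M₁`, `Ω₀` a top domain containing the
`(d+11)L`-neighbourhood of `Ω₁`, and `c₀` a bond of `T^{(j)}`, `1 ≤ j ≤ k` (standing range), ONE OF WHOSE END-POINT CENTRES LIES IN `Ω_j`.  Then every fine plaquette of the
box of radius `(d+10)·L^j` around the bottom `embIter j c₀₋` of the chain of block centres below `c₀₋` meets `Ω_{j−1}` (resp. `Ω₀` for `j = 1`): it belongs to
`Sect2.omegaPlaqsTop s.Ω Ω₀ (j − 1)`, the plaquette set on which [15]'s class (6) is read at scale `j − 1`.  (Corner within `(d+10)L^j + L^j ≤ L^jM₁` of a point of `Ω_j`;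
separation «dist(Ω_j, Ωᶜ_{j−1}) ≥ L^jM₁».) [cite: Balaban1985RegularSpaces, (1.3)–(1.7) p.77; Balaban1985Variational, (2) p.278; Balaban1985Averaging, Prop. 2 (52) p.26] -/
theorem readBox_subset_omegaPlaqsTop {ν : Stage7Numerics} {M : ℕ} {g : ℕ → ℝ} (s : SeqOfRecord F ν M g K k)
    (hsep : Sect2.SeqSeparated ν.M₁ s) (hM₁ : (F.P K).d + 11 ≤ ν.M₁) {Ω₀ : Set (Site (F.P K) 0)}
    (hΩ₀ : ∀ x ∈ s.Ω 1, ∀ z : Site (F.P K) 0, (∀ i, coordDist z x i ≤ ((F.P K).d + 11) * (F.P K).L) → z ∈ Ω₀)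
    (hk : k ≤ (F.P K).m + (F.P K).K) {j : ℕ} (hj1 : 1 ≤ j) (hjk : j ≤ k) {c₀ : PBond (F.P K) j}
    (hc₀ : embIter j c₀.src ∈ s.Ω j ∨ embIter j c₀.tgt ∈ s.Ω j) {xs : (l : ℕ) → Site (F.P K) l} (hxs : xs j = c₀.src)
    (hch : ∀ l, l < j → xs l = emb (xs (l + 1))) :
    (↑(boxRegion (xs 0) (((F.P K).d + 10) * (F.P K).L ^ j)) : Set (Plaq (F.P K) 0)) ⊆ Sect2.omegaPlaqsTop s.Ω Ω₀ (j - 1) := by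
  intro q hq
  have hq' : q ∈ boxRegion (xs 0) (((F.P K).d + 10) * (F.P K).L ^ j) := Finset.mem_coe.mp hq
  have h0 : xs 0 = embIter j c₀.src := by rw [← hxs]; exact embChain_zero_eq_embIter j xs hch
  -- an end-point image `x' ∈ Ω_j` within `L^j` of `embIter j c₀.src`
  obtain ⟨x', hx'Ω, hx'⟩ : ∃ x' ∈ s.Ω j, ∀ i, coordDist (embIter j c₀.src) x' i ≤ (F.P K).L ^ j := by
    rcases hc₀ with h | h
    · exact ⟨_, h, fun i => by rw [B15Claim189LambdaPin.coordDist_self]; exact Nat.zero_le _⟩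
    · exact ⟨_, h, fun i => coordDist_embIter_tgt_le (hjk.trans hk) c₀ i⟩
  -- the corner of `q` is within `(d+11)L^j` of `x'`
  have hnear : ∀ i, coordDist q.src x' i ≤ ((F.P K).d + 11) * (F.P K).L ^ j := fun i => by
    have h1 := coordDist_le_of_mem_boxRegion_zero hq' i
    rw [h0] at h1
    calc coordDist q.src x' i ≤ coordDist q.src (embIter j c₀.src) i + coordDist (embIter j c₀.src) x' i := coordDist_triangle _ _ _ _
      _ ≤ ((F.P K).d + 10) * (F.P K).L ^ j + (F.P K).L ^ j := add_le_add h1 (hx' i)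
      _ = ((F.P K).d + 11) * (F.P K).L ^ j := by ring
  -- hence the corner lies in the previous domain
  have hsrc : q.src ∈ (if j - 1 = 0 then Ω₀ else s.Ω (j - 1)) := by
    rcases Nat.lt_or_ge j 2 with hj2 | hj2
    · have hj : j = 1 := by omega
      subst hj
      rw [if_pos rfl]
      exact hΩ₀ x' hx'Ω q.src (fun i => by simpa [pow_one] using hnear i)
    · obtain ⟨n, rfl⟩ : ∃ n, j = n + 1 := ⟨j - 1, by omega⟩
      rw [Nat.add_sub_cancel, if_neg (by omega)]
      refine mem_omega_of_coordDist_le s hsep (by omega) (by omega) (by omega) hx'Ω fun i => (hnear i).trans ?_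
      show ((F.P K).d + 11) * (F.P K).L ^ (n + 1) ≤ (F.P K).L ^ (n + 1) * ν.M₁
      rw [mul_comm]
      exact Nat.mul_le_mul_left _ hM₁
  show q ∈ plaqsOf (if j - 1 = 0 then Ω₀ else s.Ω (j - 1))
  exact (mem_plaqsOf _ q).2 (Or.inl hsrc)

/-! ## §3  The guarded family of the class on a top domain (`∃ S`: `S 0 = univ`, closed below, `α`-guarded, containing the pins over the tower) -/

/-- ★★ **THE GUARDED FAMILY OF [15]'s CLASS (6) ON A TOP DOMAIN.**  Let `s` be a separated (2.18) index (`Sect2.SeqSeparated ν.M₁ s`) with `d + 11 ≤ M₁`, `Ω₀` a top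
domain containing the `(d+11)L`-neighbourhood of `Ω₁`, `k` in the standing range, and `U` a fine configuration with (1.7) ON THE TOP DOMAIN at every scale `n < k`:
`|U(∂p) − 1| < ε₀η_n²` for `p ∈ Sect2.omegaPlaqsTop s.Ω Ω₀ n`, where `0 < ε₀`, `C₀(d)·ε₀L² ≤ ⅓`, `ε₀L² ≤ δ_N∕((d+4)L)²` and
`(((d+2)L)²∕4)·(ε₀L² + 2C₀(d)(ε₀L²)²) ≤ α`.  Then there is a family `S = (S_i)` of bonds with `S_0 =` all fine bonds, CLOSED DOWNWARD under the (0.4) window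
(`c ∈ S_{i+1} ⇒` every bond issuing from `B(c₋) ∪ B(c₊)` is in `S_i`), `α`-GUARDED (every (0.4) loop variable of `Ū^i U` at every `c ∈ S_{i+1}`, `i + 1 ≤ k`, within `α`
of `1`), and containing every bond of `T^{(j)}`, `1 ≤ j ≤ k`, with an end-point centre in `Ω_j` — the binders `S`, `hS`, `hα`, `h𝔹S` of `…CentralResponseOnto` §4.  `S` is
the dependency hull of those pins (`LocalSmallLoop.hull`); the guard is `LocalSmallLoop.nestedSmallOn_hull_of_plaqSmallOn_readBoxes` ([B7] Props. 1–2 LOCAL + local Stokes)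
on the read boxes of §2, where the class at scale `j − 1` reads `ε₀η_{j−1}² = (ε₀L²)(L^j)⁻²`.
[cite: Balaban1985Variational, (2),(6) p.278, (45) p.285, Prop. 8 p.304; Balaban1985Averaging, Prop. 1 (51), Prop. 2 (52)–(54) p.26, (15) p.19; Balaban1987RG1, (0.4) p.253; Balaban1985RegularSpaces, (1.3)–(1.7) p.77] -/
theorem exists_guardedFamily_of_classTopAt {ν : Stage7Numerics} {M : ℕ} {g : ℕ → ℝ} (s : SeqOfRecord F ν M g K k)
    (hsep : Sect2.SeqSeparated ν.M₁ s) (hM₁ : (F.P K).d + 11 ≤ ν.M₁) {Ω₀ : Set (Site (F.P K) 0)}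
    (hΩ₀ : ∀ x ∈ s.Ω 1, ∀ z : Site (F.P K) 0, (∀ i, coordDist z x i ≤ ((F.P K).d + 11) * (F.P K).L) → z ∈ Ω₀)
    (hk : k ≤ (F.P K).m + (F.P K).K) {ε₀ α : ℝ} (hε₀ : 0 < ε₀)
    (hε3 : (143 * (((((F.P K).d + 4 : ℕ) : ℝ)) ^ 2 / 4) ^ 2) * (ε₀ * ((F.P K).L : ℝ) ^ 2) ≤ 1 / 3)
    (hε2 : 2 * (ε₀ * ((F.P K).L : ℝ) ^ 2) ≤ 2 * deltaSU (Fin N) / ((((F.P K).d + 4) * (F.P K).L : ℕ) : ℝ) ^ 2)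
    (hα : ((((F.P K).d + 2) * (F.P K).L : ℕ) : ℝ) ^ 2 / 4 *
        (ε₀ * ((F.P K).L : ℝ) ^ 2 + 2 * (143 * (((((F.P K).d + 4 : ℕ) : ℝ)) ^ 2 / 4) ^ 2) * (ε₀ * ((F.P K).L : ℝ) ^ 2) ^ 2) ≤ α)
    {U : GaugeField (F.P K) 0 (SU N)}
    (h17 : ∀ n, n < k → PlaqSmallOn (Sect2.omegaPlaqsTop s.Ω Ω₀ n) (ε₀ * (F.P K).eta n ^ 2) U) :
    ∃ S : (i : ℕ) → Set (PBond (F.P K) i),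
      S 0 = Set.univ ∧
      (∀ (i : ℕ) (c : PBond (F.P K) (i + 1)), i + 1 ≤ k → c ∈ S (i + 1) →
        ∀ b : PBond (F.P K) i, (blockOf b.src = c.src ∨ blockOf b.src = c.tgt) → b ∈ S i) ∧
      (∀ (i : ℕ) (c : PBond (F.P K) (i + 1)), i + 1 ≤ k → c ∈ S (i + 1) →
        ∀ idx : Idx (F.P K), dist1 (loopHol (avgFamily (avOfRecord F N K) U i) c idx) ≤ α) ∧
      (∀ j, 1 ≤ j → j ≤ k → ∀ b : PBond (F.P K) j, (embIter j b.src ∈ s.Ω j ∨ embIter j b.tgt ∈ s.Ω j) → b ∈ S j) := by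
  set R : (i : ℕ) → Set (PBond (F.P K) i) :=
    fun j => {b | 1 ≤ j ∧ j ≤ k ∧ (embIter j b.src ∈ s.Ω j ∨ embIter j b.tgt ∈ s.Ω j)} with hR
  have hRk : ∀ i, (F.P K).m + (F.P K).K < i → R i = ∅ := fun i hi =>
    Set.eq_empty_of_forall_notMem fun b hb => absurd (hb.2.1.trans hk) (not_le.mpr hi)
  have hmem : U ∈ NestedSmallOn (expMeanLogSU (n := Fin N)) α (hull R) k := by
    refine nestedSmallOn_hull_of_plaqSmallOn_readBoxes hRk hk (three_le_L _) (mul_pos hε₀ (pow_pos (Nat.cast_pos.mpr (F.P K).L_pos) 2)) hε3 hε2 hα ?_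
    intro i₀ hi₀ c₀ hc₀ xs hxs hch
    obtain ⟨h1, hik, hc₀'⟩ := hc₀
    have hsub := readBox_subset_omegaPlaqsTop s hsep hM₁ hΩ₀ hk h1 hik hc₀' hxs hch
    intro p hp
    have hlt := h17 (i₀ - 1) (by omega) p (hsub hp)
    refine hlt.trans_le (le_of_eq ?_)
    obtain ⟨n, rfl⟩ : ∃ n, i₀ = n + 1 := ⟨i₀ - 1, by omega⟩
    rw [Nat.add_sub_cancel, Params.eta, pow_succ ((F.P K).L : ℝ) n, mul_inv, ← inv_pow]
    have hL : ((F.P K).L : ℝ) ≠ 0 := by exact_mod_cast (F.P K).L_pos.ne'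
    calc ε₀ * (((F.P K).L : ℝ)⁻¹ ^ n) ^ 2
        = ε₀ * (((F.P K).L : ℝ)⁻¹ ^ n) ^ 2 * (((F.P K).L : ℝ) * ((F.P K).L : ℝ)⁻¹) ^ 2 := by
          rw [mul_inv_cancel₀ hL, one_pow, mul_one]
      _ = ε₀ * ((F.P K).L : ℝ) ^ 2 * (((F.P K).L : ℝ)⁻¹ ^ n * ((F.P K).L : ℝ)⁻¹) ^ 2 := by ring
  refine ⟨fun i => if i = 0 then Set.univ else hull R i, if_pos rfl, ?_, ?_, ?_⟩
  · intro i c hi hc b hb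
    by_cases hi0 : i = 0
    · subst hi0; exact Set.mem_univ _
    · have hc' : c ∈ hull R (i + 1) := by simpa only [if_neg (Nat.succ_ne_zero i)] using hc
      show b ∈ (if i = 0 then Set.univ else hull R i)
      rw [if_neg hi0]
      exact depClosed_hull R i c hc' b hb
  · intro i c hi hc idx
    have hc' : c ∈ hull R (i + 1) := by simpa only [if_neg (Nat.succ_ne_zero i)] using hc
    exact hmem i (Nat.lt_of_succ_le hi) c hc' idx
  · intro j hj1 hjk b hb
    show b ∈ (if j = 0 then Set.univ else hull R j)
    rw [if_neg (by omega)]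
    exact subset_hull R j ⟨hj1, hjk, hb⟩

/-- ★★ **THE GUARDED FAMILY AT THE SUPPORT OF RECORD** (`Ω₀ := Node00.suppDomOfRecord F ν K s.Ω` = `Ω₁` + one layer of `M₁`-cubes, the top domain of K0⁷'s stub 1
`Prop8StepCoPAt`): §3's family under the single floor `(d+11)·L ≤ M₁`. [cite: Balaban1985Variational, (1) p.277, (2),(6) p.278, Prop. 8 p.304; Balaban1988Convergent, p.255; Balaban1985Averaging, Prop. 2 (52)–(54) p.26] -/
theorem exists_guardedFamily_of_classTop {ν : Stage7Numerics} {M : ℕ} {g : ℕ → ℝ} (s : SeqOfRecord F ν M g K k)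
    (hsep : Sect2.SeqSeparated ν.M₁ s) (hM₁ : ((F.P K).d + 11) * (F.P K).L ≤ ν.M₁) (hk : k ≤ (F.P K).m + (F.P K).K) {ε₀ α : ℝ} (hε₀ : 0 < ε₀)
    (hε3 : (143 * (((((F.P K).d + 4 : ℕ) : ℝ)) ^ 2 / 4) ^ 2) * (ε₀ * ((F.P K).L : ℝ) ^ 2) ≤ 1 / 3)
    (hε2 : 2 * (ε₀ * ((F.P K).L : ℝ) ^ 2) ≤ 2 * deltaSU (Fin N) / ((((F.P K).d + 4) * (F.P K).L : ℕ) : ℝ) ^ 2)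
    (hα : ((((F.P K).d + 2) * (F.P K).L : ℕ) : ℝ) ^ 2 / 4 *
        (ε₀ * ((F.P K).L : ℝ) ^ 2 + 2 * (143 * (((((F.P K).d + 4 : ℕ) : ℝ)) ^ 2 / 4) ^ 2) * (ε₀ * ((F.P K).L : ℝ) ^ 2) ^ 2) ≤ α)
    {U : GaugeField (F.P K) 0 (SU N)}
    (h17 : ∀ n, n < k → PlaqSmallOn (Sect2.omegaPlaqsTop s.Ω (suppDomOfRecord F ν K s.Ω) n) (ε₀ * (F.P K).eta n ^ 2) U) :
    ∃ S : (i : ℕ) → Set (PBond (F.P K) i),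
      S 0 = Set.univ ∧
      (∀ (i : ℕ) (c : PBond (F.P K) (i + 1)), i + 1 ≤ k → c ∈ S (i + 1) →
        ∀ b : PBond (F.P K) i, (blockOf b.src = c.src ∨ blockOf b.src = c.tgt) → b ∈ S i) ∧
      (∀ (i : ℕ) (c : PBond (F.P K) (i + 1)), i + 1 ≤ k → c ∈ S (i + 1) →
        ∀ idx : Idx (F.P K), dist1 (loopHol (avgFamily (avOfRecord F N K) U i) c idx) ≤ α) ∧
      (∀ j, 1 ≤ j → j ≤ k → ∀ b : PBond (F.P K) j, (embIter j b.src ∈ s.Ω j ∨ embIter j b.tgt ∈ s.Ω j) → b ∈ S j) := by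
  have hpos : 0 < ((F.P K).d + 11) * (F.P K).L := Nat.mul_pos (Nat.succ_pos _) (F.P K).L_pos
  exact exists_guardedFamily_of_classTopAt s hsep ((Nat.le_mul_of_pos_right _ (F.P K).L_pos).trans hM₁)
    (fun x hx z hz => mem_suppDomOfRecord_of_coordDist_le (hpos.trans_le hM₁) s.Ω hx fun i => (hz i).trans hM₁) hk hε₀ hε3 hε2 hα h17

/-- **THE LITERAL STUB-1 PINS QUALIFY**: [III] (2.2)'s `Γ_j ⊆ Ω_j^{(j)}` for `1 ≤ j ≤ k` (`Γ_j = Ω_j^{(j)}∖Ω_{j+1}^{(j)}`, `Γ_k = Ω_k^{(k)}`), so every bond meeting `Γ_j`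
(r12's `bondsOf (genSet Ω k j)`, reading (b)) has an end-point centre in `Ω_j`; at `j = 0` the family is everything. [cite: Balaban1988Convergent, (2.2) p.255, (2.10) p.256] -/
theorem bondsOf_genSet_subset_of_pins {S : (i : ℕ) → Set (PBond (F.P K) i)} (Ω : ℕ → Set (Site (F.P K) 0)) (h0 : S 0 = Set.univ)
    (hpin : ∀ j, 1 ≤ j → j ≤ k → ∀ b : PBond (F.P K) j, (embIter j b.src ∈ Ω j ∨ embIter j b.tgt ∈ Ω j) → b ∈ S j) :
    ∀ j, j ≤ k → bondsOf (genSet Ω k j) ⊆ S j := by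
  intro j hjk b hb
  rcases Nat.eq_zero_or_pos j with rfl | hj
  · rw [h0]; exact Set.mem_univ _
  · refine hpin j hj hjk b ?_
    have hΓ : gammaRegion Ω k j ⊆ Ω j := by
      rcases hjk.lt_or_eq with hlt | rfl
      · rw [gammaRegion_mid Ω hj hlt]; exact fun x hx => hx.1
      · rw [gammaRegion_self]
    rcases hb with hb | hb
    · exact Or.inl (hΓ hb)
    · exact Or.inr (hΓ hb)

/-- **THE `h𝔹S` BINDER FOR ANY DETERMINING SET WITH PINS OVER THE TOWER**: for a level-indexed `𝔹` whose bonds at level `j` (`1 ≤ j ≤ k`) have an end-point centre in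
`Ω_j`, §3's family contains `bondsOf (𝔹 j)` for every `j ≤ k`. [cite: Balaban1988Convergent, (2.2), (2.10) p.255–256; Balaban1985Variational, (7) p.278] -/
theorem exists_guardedFamily_of_classTop_detSet {ν : Stage7Numerics} {M : ℕ} {g : ℕ → ℝ} (s : SeqOfRecord F ν M g K k)
    (hsep : Sect2.SeqSeparated ν.M₁ s) (hM₁ : ((F.P K).d + 11) * (F.P K).L ≤ ν.M₁) (hk : k ≤ (F.P K).m + (F.P K).K) {ε₀ α : ℝ} (hε₀ : 0 < ε₀)
    (hε3 : (143 * (((((F.P K).d + 4 : ℕ) : ℝ)) ^ 2 / 4) ^ 2) * (ε₀ * ((F.P K).L : ℝ) ^ 2) ≤ 1 / 3)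
    (hε2 : 2 * (ε₀ * ((F.P K).L : ℝ) ^ 2) ≤ 2 * deltaSU (Fin N) / ((((F.P K).d + 4) * (F.P K).L : ℕ) : ℝ) ^ 2)
    (hα : ((((F.P K).d + 2) * (F.P K).L : ℕ) : ℝ) ^ 2 / 4 *
        (ε₀ * ((F.P K).L : ℝ) ^ 2 + 2 * (143 * (((((F.P K).d + 4 : ℕ) : ℝ)) ^ 2 / 4) ^ 2) * (ε₀ * ((F.P K).L : ℝ) ^ 2) ^ 2) ≤ α)
    {𝔹 : DetSet (F.P K)} (h𝔹Ω : ∀ j, 1 ≤ j → j ≤ k → ∀ b ∈ bondsOf (𝔹 j), embIter j b.src ∈ s.Ω j ∨ embIter j b.tgt ∈ s.Ω j)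
    {U : GaugeField (F.P K) 0 (SU N)}
    (h17 : ∀ n, n < k → PlaqSmallOn (Sect2.omegaPlaqsTop s.Ω (suppDomOfRecord F ν K s.Ω) n) (ε₀ * (F.P K).eta n ^ 2) U) :
    ∃ S : (i : ℕ) → Set (PBond (F.P K) i),
      (∀ (i : ℕ) (c : PBond (F.P K) (i + 1)), i + 1 ≤ k → c ∈ S (i + 1) →
        ∀ b : PBond (F.P K) i, (blockOf b.src = c.src ∨ blockOf b.src = c.tgt) → b ∈ S i) ∧
      (∀ (i : ℕ) (c : PBond (F.P K) (i + 1)), i + 1 ≤ k → c ∈ S (i + 1) →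
        ∀ idx : Idx (F.P K), dist1 (loopHol (avgFamily (avOfRecord F N K) U i) c idx) ≤ α) ∧
      (∀ j, j ≤ k → bondsOf (𝔹 j) ⊆ S j) := by
  obtain ⟨S, h0, hS, hαS, hpin⟩ := exists_guardedFamily_of_classTop s hsep hM₁ hk hε₀ hε3 hε2 hα h17
  refine ⟨S, hS, hαS, fun j hjk b hb => ?_⟩
  rcases Nat.eq_zero_or_pos j with rfl | hj
  · rw [h0]; exact Set.mem_univ _
  · exact hpin j hj hjk b (h𝔹Ω j hj hjk b hb)

end Record

/-! ## §4  Non-vacuity (A6): the `ε₀`∕`α` windows are jointly inhabited for every `(d, L, N)` -/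

section Windows

variable (P : Params) (N : ℕ) [NeZero N]

/-- **THE `ε₀`∕`α` WINDOWS ARE JOINTLY INHABITED** for every `(d, L, N)`: `α := min{1∕24, δ_N∕2, L^{1−d}∕158}`, `ε₀L² := min{1, 1∕(3C₀), δ_N∕((d+4)L)²,
α∕(Q(1+2C₀))}` with `Q = ((d+2)L)²∕4`, `C₀ = 143((d+4)²∕4)²`. [cite: Balaban1985Averaging, Prop. 2 p.26 («for α₀ sufficiently small»); Balaban1985Variational, Prop. 8 p.304 («ε₀ ≦ a₅»)] -/
theorem exists_windows :
    ∃ ε₀ α : ℝ, 0 < ε₀ ∧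
      (143 * ((((P.d + 4 : ℕ) : ℝ)) ^ 2 / 4) ^ 2) * (ε₀ * (P.L : ℝ) ^ 2) ≤ 1 / 3 ∧
      2 * (ε₀ * (P.L : ℝ) ^ 2) ≤ 2 * deltaSU (Fin N) / (((P.d + 4) * P.L : ℕ) : ℝ) ^ 2 ∧
      (((P.d + 2) * P.L : ℕ) : ℝ) ^ 2 / 4 *
          (ε₀ * (P.L : ℝ) ^ 2 + 2 * (143 * ((((P.d + 4 : ℕ) : ℝ)) ^ 2 / 4) ^ 2) * (ε₀ * (P.L : ℝ) ^ 2) ^ 2) ≤ α ∧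
      α ≤ 1 / 24 ∧ α < deltaSU (Fin N) ∧ 157 * α < ((P.L : ℝ) ^ (P.d - 1))⁻¹ := by
  set C₀ : ℝ := 143 * ((((P.d + 4 : ℕ) : ℝ)) ^ 2 / 4) ^ 2 with hC₀
  set Q : ℝ := (((P.d + 2) * P.L : ℕ) : ℝ) ^ 2 / 4 with hQ
  set D : ℝ := (((P.d + 4) * P.L : ℕ) : ℝ) ^ 2 with hD
  set Λ : ℝ := ((P.L : ℝ) ^ (P.d - 1))⁻¹ with hΛ
  have hL : (0 : ℝ) < P.L := Nat.cast_pos.mpr P.L_pos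
  have hδ : 0 < deltaSU (Fin N) := ExpMeanLog.deltaSU_pos
  have hC₀pos : 0 < C₀ := by rw [hC₀]; positivity
  have hQpos : 0 < Q := by
    rw [hQ]; have : (0 : ℝ) < (((P.d + 2) * P.L : ℕ) : ℝ) := by exact_mod_cast Nat.mul_pos (Nat.succ_pos _) P.L_pos
    positivity
  have hDpos : 0 < D := by
    rw [hD]; have : (0 : ℝ) < (((P.d + 4) * P.L : ℕ) : ℝ) := by exact_mod_cast Nat.mul_pos (Nat.succ_pos _) P.L_pos
    positivity
  have hΛpos : 0 < Λ := by rw [hΛ]; positivity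
  -- the guard radius `α`
  set α : ℝ := min (1 / 24) (min (deltaSU (Fin N) / 2) (Λ / 158)) with hα
  have hαpos : 0 < α := by rw [hα]; exact lt_min (by norm_num) (lt_min (half_pos hδ) (div_pos hΛpos (by norm_num)))
  have hα24 : α ≤ 1 / 24 := min_le_left _ _
  have hαδ : α < deltaSU (Fin N) := (min_le_right _ _).trans_lt ((min_le_left _ _).trans_lt (half_lt_self hδ))
  have hαΛ : 157 * α < Λ := by
    have h1 : α ≤ Λ / 158 := (min_le_right _ _).trans (min_le_right _ _)
    nlinarith
  -- the class radius `ε₀ = x ∕ L²`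
  set x : ℝ := min 1 (min (1 / (3 * C₀)) (min (deltaSU (Fin N) / D) (α / (Q * (1 + 2 * C₀))))) with hx
  have hxpos : 0 < x := by
    rw [hx]
    exact lt_min one_pos (lt_min (div_pos one_pos (by positivity)) (lt_min (div_pos hδ hDpos) (div_pos hαpos (by positivity))))
  have hx1 : x ≤ 1 := min_le_left _ _
  have hx3 : x ≤ 1 / (3 * C₀) := (min_le_right _ _).trans (min_le_left _ _)
  have hxD : x ≤ deltaSU (Fin N) / D := (min_le_right _ _).trans ((min_le_right _ _).trans (min_le_left _ _))
  have hxα : x ≤ α / (Q * (1 + 2 * C₀)) := (min_le_right _ _).trans ((min_le_right _ _).trans (min_le_right _ _))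
  refine ⟨x / (P.L : ℝ) ^ 2, α, div_pos hxpos (pow_pos hL 2), ?_, ?_, ?_, hα24, hαδ, hαΛ⟩
  · have e : x / (P.L : ℝ) ^ 2 * (P.L : ℝ) ^ 2 = x := div_mul_cancel₀ x (pow_ne_zero 2 hL.ne')
    rw [e]
    calc C₀ * x ≤ C₀ * (1 / (3 * C₀)) := mul_le_mul_of_nonneg_left hx3 hC₀pos.le
      _ = 1 / 3 := by field_simp
  · have e : x / (P.L : ℝ) ^ 2 * (P.L : ℝ) ^ 2 = x := div_mul_cancel₀ x (pow_ne_zero 2 hL.ne')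
    rw [e]
    have h1 : x * D ≤ deltaSU (Fin N) := by rwa [le_div_iff₀ hDpos] at hxD
    rw [le_div_iff₀ hDpos]
    linarith
  · have e : x / (P.L : ℝ) ^ 2 * (P.L : ℝ) ^ 2 = x := div_mul_cancel₀ x (pow_ne_zero 2 hL.ne')
    rw [e]
    have hQC : 0 < Q * (1 + 2 * C₀) := by positivity
    have h1 : x * (Q * (1 + 2 * C₀)) ≤ α := by rwa [le_div_iff₀ hQC] at hxα
    have h2 : x ^ 2 ≤ x := by nlinarith
    calc Q * (x + 2 * C₀ * x ^ 2) ≤ Q * (x + 2 * C₀ * x) := by gcongr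
      _ = x * (Q * (1 + 2 * C₀)) := by ring
      _ ≤ α := h1

end Windows

end Summit.QuantumFields.YangMills.BalabanUVNodes.N07GuardedFamilyOfClassTop

end
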